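import Mathlib
import Summits.Ventures.HodgeRepro.Tier4.Target

/-!
# Tier4/Line3/GaussCountRay — a Gaussian count with a positive profile exponent vanishes along the integer ray

Blind re-derivation cell `pub-hodge-repro`, Tier 4 «PROVE THE STEP», LINE L3, seat t4-x2 (g3, reserve wall-breaker); the
analytic core of the `≤ θ₁` half of v0.44's pure count (bus S13961 (ii)): scaling the centre `xm ↦ n • xm` along the
integer ray multiplies every size (`tauSize`, `defQuad`) by `n²`, so the majorant of a copy becomes `w(ε) · exp(−π n² E(ε))`
with a FIXED weight `w(ε) ≥ 0` and the PROFILE EXPONENT `E(ε) = Σ_j (t_j² − 1)⁺ tauSize (xm j) + defSize ε xm` of the base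
centre.  Pure real analysis (Mathlib only):

* **`tendsto_tsum_gauss_ray`** (Tannery): if the count is summable at `n = 1` and `E(ε) > 0` on every index (the
  PROFILE CONDITION of bus S13860 (F2)), then `Σ'_ε w(ε) exp(−π n² E(ε)) → 0` as `n → ∞` — dominated convergence,
  `tendsto_tsum_of_dominated_convergence`, with the `n = 1` terms as the dominating function (`E ≥ 0`, `n ≥ 1`);
* `eventually_tsum_gauss_ray_le`: for every `θ > 0` the count is `≤ θ` from some `n` on;
* `summable_gauss_ray`: the count is summable at every `n ≥ 1` (comparison with `n = 1`).

What this does NOT contain: the profile condition itself (field-dependent, ARCH-COPY-PROFILE-x2.md §3), the uniformity in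
`n` of the exponential-moment constants (HK) of CopyWeightBoundShrink along the ray, and the identification of the count over
orbits at the centre `n • xm` with a count over a fixed set of scalar tuples — the T4Data wrapper of a later module.

Nothing here says anything about the status of the Hodge conjecture for CM abelian varieties, which is NOT proved
(HC_CM is NOT proved by anyone in this repository).
-/

set_option autoImplicit false

noncomputable section

namespace Summit.Ventures.HodgeRepro.Tier4.Line3

open Filter Topology

variable {ι : Type}

/-- The Gaussian count at scale `n`: `Σ'_i w i · exp(−π n² E i)`. -/
def gaussCount (w E : ι → ℝ) (n : ℕ) : ℝ := ∑' i, w i * Real.exp (-(Real.pi * (n : ℝ) ^ 2 * E i))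

/-- For `n ≥ 1` and `E i ≥ 0`, the term at scale `n` is at most the term at scale `1`. -/
theorem term_le_term_one {w E : ι → ℝ} (hw : ∀ i, 0 ≤ w i) (hE : ∀ i, 0 ≤ E i) {n : ℕ} (hn : 1 ≤ n) (i : ι) :
    w i * Real.exp (-(Real.pi * (n : ℝ) ^ 2 * E i)) ≤ w i * Real.exp (-(Real.pi * E i)) := by
  refine mul_le_mul_of_nonneg_left (Real.exp_le_exp.2 ?_) (hw i)
  have hn' : (1 : ℝ) ≤ n := by exact_mod_cast hn
  have h1 : (1 : ℝ) ≤ (n : ℝ) ^ 2 := by nlinarith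
  nlinarith [Real.pi_pos, hE i, mul_nonneg (mul_nonneg Real.pi_pos.le (hE i)) (sub_nonneg.2 h1)]

/-- Each term vanishes along the ray when its profile exponent is positive. -/
theorem tendsto_term_ray {w E : ι → ℝ} (hE : ∀ i, 0 < E i) (i : ι) :
    Tendsto (fun n : ℕ => w i * Real.exp (-(Real.pi * (n : ℝ) ^ 2 * E i))) atTop (𝓝 0) := by
  have h1 : Tendsto (fun n : ℕ => Real.pi * (n : ℝ) ^ 2 * E i) atTop atTop := by
    have h2 : Tendsto (fun n : ℕ => (n : ℝ) ^ 2) atTop atTop :=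
      (tendsto_pow_atTop two_ne_zero).comp tendsto_natCast_atTop_atTop
    have h3 : Tendsto (fun n : ℕ => Real.pi * (n : ℝ) ^ 2) atTop atTop := h2.const_mul_atTop Real.pi_pos
    exact h3.atTop_mul_const (hE i)
  have h4 : Tendsto (fun n : ℕ => Real.exp (-(Real.pi * (n : ℝ) ^ 2 * E i))) atTop (𝓝 0) :=
    Real.tendsto_exp_neg_atTop_nhds_zero.comp h1
  simpa using h4.const_mul (w i)

/-- The count is summable at every scale `n ≥ 1` if it is summable at `n = 1`. -/
theorem summable_gauss_ray {w E : ι → ℝ} (hw : ∀ i, 0 ≤ w i) (hE : ∀ i, 0 ≤ E i)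
    (hs : Summable fun i => w i * Real.exp (-(Real.pi * E i))) {n : ℕ} (hn : 1 ≤ n) :
    Summable fun i => w i * Real.exp (-(Real.pi * (n : ℝ) ^ 2 * E i)) :=
  Summable.of_nonneg_of_le (fun i => mul_nonneg (hw i) (Real.exp_pos _).le) (term_le_term_one hw hE hn) hs

/-- **TANNERY ALONG THE RAY**: a Gaussian count with positive profile exponents, summable at the base scale, tends to `0`. -/
theorem tendsto_tsum_gauss_ray {w E : ι → ℝ} (hw : ∀ i, 0 ≤ w i) (hE : ∀ i, 0 < E i)
    (hs : Summable fun i => w i * Real.exp (-(Real.pi * E i))) :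
    Tendsto (gaussCount w E) atTop (𝓝 0) := by
  have h := tendsto_tsum_of_dominated_convergence (𝓕 := atTop) (f := fun (n : ℕ) (i : ι) =>
      w i * Real.exp (-(Real.pi * (n : ℝ) ^ 2 * E i))) (g := fun _ => (0 : ℝ))
      (bound := fun i => w i * Real.exp (-(Real.pi * E i))) hs (fun i => tendsto_term_ray hE i) ?_
  · have h' : Tendsto (fun n : ℕ => ∑' i, w i * Real.exp (-(Real.pi * (n : ℝ) ^ 2 * E i))) atTop (𝓝 0) := by
      simpa using h
    exact h'
  · refine Filter.eventually_atTop.2 ⟨1, fun n hn i => ?_⟩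
    rw [Real.norm_of_nonneg (mul_nonneg (hw i) (Real.exp_pos _).le)]
    exact term_le_term_one hw (fun i => (hE i).le) hn i

/-- For every `θ > 0` the count is `≤ θ` from some scale on. -/
theorem eventually_tsum_gauss_ray_le {w E : ι → ℝ} (hw : ∀ i, 0 ≤ w i) (hE : ∀ i, 0 < E i)
    (hs : Summable fun i => w i * Real.exp (-(Real.pi * E i))) {θ : ℝ} (hθ : 0 < θ) :
    ∀ᶠ n : ℕ in atTop, gaussCount w E n ≤ θ := by
  have h := tendsto_tsum_gauss_ray hw hE hs
  have h2 : ∀ᶠ n : ℕ in atTop, gaussCount w E n < θ :=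
    (tendsto_order.1 h).2 θ hθ
  exact h2.mono fun n hn => hn.le

end Summit.Ventures.HodgeRepro.Tier4.Line3

end
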